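import Summits.ResolutionOfSingularities.ResolutionOfSingularities.Theorems.HilbertSamuelEliminationCampaignW42TertiaryReduction
import Summits.ResolutionOfSingularities.ResolutionOfSingularities.Theorems.HilbertSamuelEliminationCampaignW42TertiaryLiveness
import Summits.ResolutionOfSingularities.ResolutionOfSingularities.Theorems.HilbertSamuelEliminationCampaignW42NearChainCorridor3
import Summits.ResolutionOfSingularities.ResolutionOfSingularities.Theorems.HilbertSamuelEliminationSigmaMaxModificationsCorridor3TameWildDefs
import Literature.AlgebraicGeometry.CossartJannsenSaito2020.KeyTheoremsIsolated
import Literature.AlgebraicGeometry.Resolution.HilbertSamuelStrata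
import Literature.AlgebraicGeometry.Resolution.BlowupSequencesAppend
import Literature.AlgebraicGeometry.Resolution.SurfaceResolutionPermissibleCentres
import Mathlib.AlgebraicGeometry.Noetherian
import Mathlib.FieldTheory.Perfect
import HarnessLib

/-!
# CHAIN w42 — W-LADDER DEFINITIONS MODULE, helpers v3.5 (planner res-L1-w42-plan-1, gen 5, 2026-08-27)

[OURS · L1 W4.2] DEFINITIONS MODULE of the W-LADDER for the crux `SigmaMaxModifications` (stmt-ResolutionOfSingularities-18506),
attacked conjunct `SigmaMaxModificationsCorridor3` (stmt-…-19249), line `w_ladder` v4 (supersedes `tame_wild` v3.1 as line of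
record once registered). Drafted by the crux planner; SORRY-FREE; to be landed VERBATIM by a typer seat as
`Theorems/HilbertSamuelEliminationSigmaMaxModificationsCorridor3WLadder.lean --supports stmt-ResolutionOfSingularities-18506 --as helper`.
NOT a statement of any manuscript ([Hironaka2017] is never a premise); Hironaka-side content appears only as NAMED OPEN `Prop`s.
AI-drafted; AI review is weaker than expert review.

v3.5 CHANGES (vs v3.4 `7b96164b967bfa10`). (1) REBASED on the tree's `CampaignW42.IsMaximalOrigin` (p487178, res-L1-s42-pv-2):
the v3.4 structure `IsClosedOrigin` was field-for-field identical and is DELETED (typer lint: cite, do not restate); every row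
below reads `IsMaximalOrigin p N ν X x` («closed origin» = «maximal origin»). Links `nearChainTerminationAt_iff`,
`nearChainTermination_iff` identify s42's all-level items with the level-wise rows here. (2) WA IS PROVED modulo CJS Thm. 1.2:
`WA3_of_CJS` from s42-pv-2's `nuMod_threefold_of_noNearChains` (p486671/p486973) — the v3.4 rows W-pack / W-orc / W-cent are
CLOSED BY THE TREE (`nuMod_of_forall_noNearChain`, `exists_choiceOracle` + `answers_of_dim_le_three_general`,
`canonicalCentres_general`) and their packaging predicates are removed. (3) §D REGIME RE-CUT of W-low along the PRINTED standing
assumption (F1) of the key theorems (`CharHypothesis`, CJS p. 103 / Thm. 10.2, typed in `KeyTheorems.lean`): regime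
`QCharRegime p` := «`3 ≤ p` or `dim X ≤ 2`» (where (F1) holds on `{dim ≤ 3}`) versus its complement («`p = 2` and `dim X = 3`»,
OURS), each at the EXACT grades `ē = 0, 1, 2` (W-mono makes `ē` eventually constant: `closedOriginNoNearChain_of_exactGrades`,
PROVED). (4) §F the F-KEY BRIDGES (stub-2's `Bridge3` proposal 02:28Z, ADOPTED with two amendments: grade EXACTLY `2`, origin in
`QCharRegime`; plus the point-sequence bridge `Bridge3Seq` for grade `1` against `Corollary637_char`), with the PROVED reductions
`wlow3Char_e2_of_bridge` (F-key `KeyTheorem640_char`, p484877, print-faithful per res-lit-6 02:43:16Z) and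
`wlow3Char_e1_of_bridgeSeq`. (5) Support rows `WFair` (no infinite idle tail — the strategy's fairness, M) and the PROVED
dimension bookkeeping `canonicalNearStep_dim_le`.

CONTENTS. §A the C5/C6 interface `ConfineRound'` (C-ladder, banked). §B marked-stage rows over maximal origins: `InScopeC`,
`ClosedOriginNoNearChainAt p N G`, W-mono `ClosedOriginGeomDirDimNonincrease`, the graded splits (PROVED), `WFair`, links to
`NearChainTermination(At)`. §C the skeleton-level statements `WA3` (PROVED mod CJS Thm. 1.2: `WA3_of_CJS`), `WB3`, `WB_of_W`,
`WB_of_W_exact`, and `confinedWildNu3_of_WA_WB` (the registered v3.1 `TameWild.stub_confinedWildNu3` statement verbatim from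
`WA3 ∧ WB3`). §D regime / pointedness predicates and the ROW DEFINITIONS BY NAME: `Wlow3Char p`, `Wlow3Two p`
(`Wlow3TwoPerfect` / `Wlow3TwoImperfect`), `Wtop3Pointed p`, `Wtop3Nonpointed p`, with PROVED joins `wlow3_of_char_two`,
`wlow3Two_of_regimes`, `wtop3_of_pointed_nonpointed`, `WB3_of_rows`. §E the SHADOW-LAW interface (card C′, tri-2's stagewise repair;
reduction PROVED). §F the F-key bridges. Registered stubs of line `w_ladder` v4 (planner skeleton `L/w42/w_ladder_v4_draft.lean`):
`stub_cjsNuElimination`, `stub_cjsSequencePermissible` (printed facts), `stub_Wmono`, `stub_Wlow3_char`, `stub_Wlow3_two`,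
`stub_Wtop3_pointed`, `stub_Wtop3_nonpointed`; provers close rows BY THE NAMES OF THESE DEFINITIONS.

ROWS (informal; sizes are the planner's estimates, not claims):
* W-mono (`ClosedOriginGeomDirDimNonincrease p 3`, M): `ē` does not increase along a canonical near step (CJS Thm. 3.10 (4)).
* W-low-char (`Wlow3Char p`, M/L): no infinite chain of constant grade `ē = e ≤ 2` from a maximal origin with `3 ≤ p` or
  `dim X ≤ 2` — the printed key theorems' territory: `e = 2` CJS Thm. 6.40 via `Bridge3`, `e = 1` Cor. 6.37 via `Bridge3Seq`,
  `e = 0` no near point at all (CJS Thm. 3.14 in the (F1) range). Risks: B-req-1 quasi-isolation at unit starts (G1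
  `interleavedCurveInvariance3`), B-req-3 compression of idle steps (`WFair`), B-req-4 `e = ē` at unit ends (F3).
* W-low-two (`Wlow3Two p`, OURS; non-vacuous only for `p = 2`, `dim X = 3`): β perfect residue field (re-derivation of CJS
  Chs. 12–14 with the perfect-residue-field form of Thm. 3.14 — an AI reading, M/L), γ imperfect (OPEN; barrier
  `DirectrixSmallCharacteristic`).
* W-top (`Wtop3Pointed p` — card C′ via `ShadowLaw`; `Wtop3Nonpointed p` — OPEN, the core: obstruction O2 in maximal-origin form).
* WA (`WA3`): PROVED modulo CJS Thm. 1.2 (`WA3_of_CJS`).  WB (`WB3`) = W-mono ∧ W-low ∧ W-top (`WB3_of_rows`).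

SPLIT FOR THE GATE (typer res-type-053, landing plan-1's helpers v3.5 `L/w42/Corridor3WLadder.lean` sha16 `003346748a44856a`
VERBATIM): the gate caps Theorems files WITH proofs at 400 lines and relocates parameterless `def : Prop`s of non-`Defs` Theorems
files to Literature/, so THIS module `…Corridor3WLadderDefs.lean` carries every DEFINITION of helpers v3.5 (byte-identical, in the
original order, same namespace) and `…Corridor3WLadder.lean` (which imports this file — `import …Corridor3WLadder` gives both)
carries every PROVED reduction (byte-identical). Docstrings below that mention a proved reduction (`WA3_of_CJS`, `WB3_of_rows`,
`wlow3Char_e2_of_bridge`, …) refer to that companion. One more gate-forced deviation: the three PARAMETERLESS `Prop`s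
`ConfineRound'`, `WA3`, `WB3` carry their CJS pointers in prose instead of a `[cite: …]` / `[folklore]` tag (tagged closed `Prop`s are
relocated as published facts; these are OURS nodes, not citations of print); their bodies are byte-identical.

## References
* V. Cossart, U. Jannsen, S. Saito, LNM 2270 (2020): p. 103 (F1)–(F3), Rem. 6.29 (1), Def. 6.14, Thm. 3.10, Thm. 3.14,
  Def. 6.34, Thm. 6.35, Cor. 6.37, Def. 6.38/6.39, Thm. 6.40, Thm. 10.2, Def. 13.3, p. 11, p. 92, pp. 104–107. [CossartJannsenSaito2020]
-/

set_option linter.dupNamespace false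

noncomputable section

open CategoryTheory CategoryTheory.Limits AlgebraicGeometry TopologicalSpace Topology
open Literature.AlgebraicGeometry.Resolution Literature.RingTheory.HilbertSamuel
open Summit.ResolutionOfSingularities.ResolutionOfSingularities.Theorems.SigmaMaxModificationsCorridor3.TameWild
open Summit.ResolutionOfSingularities.ResolutionOfSingularities.Theorems.CampaignW42

namespace Summit.ResolutionOfSingularities.ResolutionOfSingularities.Theorems.SigmaMaxModificationsCorridor3.Helpers

universe u


/-! ## §A. C5/C6 interface — the round lemma WITH the decrease clause -/

/-- The ROUND LEMMA as a `Prop`, v3.2: helpers-v3.1 `ConfineRound` plus the export clause `T′ ⊆ T`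
(images of the top `ν`-strata before and after the round). OURS internal node (cf. CJS LNM 2270, Rem. 6.29); not a citation of
print; not asserted. -/
def ConfineRound' : Prop :=
  ∀ p : ℕ, p.Prime → ∀ (k : Type) [Field k] [CharP k p] (Y : Scheme.{0})
    (g : Y ⟶ Spec (.of k)), IsSeparated g → LocallyOfFiniteType g → QuasiCompact g →
    IsReduced Y → topologicalKrullDim Y ≤ ((3 : ℕ) : WithBot ℕ∞) →
    ∀ ν : ℕ → ℕ, Maximal (· ∈ Scheme.hsValues Y 3) ν → ν ≠ iterPSum 3 Phi →
      ∀ s : CentreSeq Y, s.AllRegular → s.CentresOver (Scheme.hsStratum Y 3 ν) →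
        (∀ x' : s.top, Scheme.hsFun s.top 3 x' ≤ Scheme.hsFun Y 3 (s.comp.base x')) →
        ∀ ξ ∈ (fun x' => s.comp.base x') '' Scheme.hsStratum s.top 3 ν,
          ¬ IsClosed ({ξ} : Set Y) →
          (∀ η ∈ (fun x' => s.comp.base x') '' Scheme.hsStratum s.top 3 ν, η ⤳ ξ → η = ξ) →
          ∃ t : CentreSeq s.top,
            (s.append t).AllRegular ∧ (s.append t).CentresOver (Scheme.hsStratum Y 3 ν) ∧
            (∀ x'' : (s.append t).top,
              Scheme.hsFun (s.append t).top 3 x'' ≤ Scheme.hsFun Y 3 ((s.append t).comp.base x'')) ∧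
            (fun x'' => (s.append t).comp.base x'') '' Scheme.hsStratum (s.append t).top 3 ν ⊆
              (fun x' => s.comp.base x') '' Scheme.hsStratum s.top 3 ν ∧
            ξ ∉ (fun x'' => (s.append t).comp.base x'') '' Scheme.hsStratum (s.append t).top 3 ν

/-! ## §B. The W-ladder — wild core in the marked-stage language, over MAXIMAL ORIGINS (`CampaignW42.IsMaximalOrigin`:
`X` reduced, separated, of finite type over a field of characteristic `p`, `dim X ≤ N`, `ν ∈ Σ_X(N)^max`, `x` a CLOSED point of
`X(ν)` of any shape — a confined stage has a positive-dimensional top stratum and cannot be isolated). -/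

/-- [OURS · L1 W4.2] `s` is reached along `S(X, ν)` from a MAXIMAL (closed) origin of characteristic `p`. [folklore] -/
def InScopeC (p : ℕ) (R : ∀ S : Scheme.{u}, CentreSeq S → Prop) (N : ℕ) (ν : ℕ → ℕ)
    (s : MarkedStage.{u}) : Prop :=
  ∃ (X : Scheme.{u}) (h : IsLocallyNoetherian X) (x : X),
    IsMaximalOrigin p N ν X x ∧ Reaches R N ν (@MarkedStage.init X h x) s

/-- [OURS · L1 W4.2] NO INFINITE NEAR CHAIN FROM ANY MAXIMAL ORIGIN, within the grade `G`, at level `N`, in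
characteristic `p`: for every functional admissible oracle, value `ν`, and closed origin `(X, x)`,
`NoNearChainFrom R N ν (init X x) G`. With `G = ⊤` and `N = 3` this is the closed-origin form of O2 on threefolds;
with `G = (ē ≤ 2)` the key theorems' share; with `G = (ē ≥ 3)` THE open core. NOT a statement of the manuscript.
[folklore] -/
def ClosedOriginNoNearChainAt (p N : ℕ) (G : MarkedStage.{u} → Prop) : Prop :=
  ∀ (R : ∀ S : Scheme.{u}, CentreSeq S → Prop), OracleFunctional R → OracleAdmissible R →
  ∀ (ν : ℕ → ℕ) (X : Scheme.{u}) [IsLocallyNoetherian X] (x : X), IsMaximalOrigin p N ν X x →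
    NoNearChainFrom R N ν (MarkedStage.init X x) G

/-- **W-mono (M): `ē` does not increase along a canonical near step** from a stage reached from a maximal origin
(CJS Thm. 3.10 (4) at near points of permissible blow-ups, all characteristics, `K` algebraically closed; plus the
permissibility of the canonical centres). [cite: CossartJannsenSaito2020, Thm. 3.10, Lemma 5.34, Thm. 3.3] -/
def ClosedOriginGeomDirDimNonincrease (p N : ℕ) : Prop :=
  ∀ (R : ∀ S : Scheme.{u}, CentreSeq S → Prop), OracleFunctional R → OracleAdmissible R →
  ∀ (ν : ℕ → ℕ) (s s' : MarkedStage.{u}), InScopeC p R N ν s → CanonicalNearStep R N ν s s' →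
    s'.geomDirDim ≤ s.geomDirDim

/-- **Support row W-fair (M): NO INFINITE IDLE TAIL.** A canonical near step `s → s'` is IDLE at the marked point when (for
some presentation of the step) its centre misses `s.pt` — then `s'` is the same germ. The strategy is FAIR: every component of
`X_n(ν)` is blown up within the current resolution cycle (CJS (6.5) labels, p. 92; s42-pv-2's cycle calculus p484582/p485148),
so along an infinite chain from a maximal origin infinitely many steps are NOT idle. Needed by the F-key bridges (B-req-3,
compression) and by W-top. NOT a statement of any manuscript. [cite: CossartJannsenSaito2020, p. 92, Rem. 6.29 (1)] -/
def CanonicalNearStep.IdleAt (R : ∀ S : Scheme.{u}, CentreSeq S → Prop) (N : ℕ) (ν : ℕ → ℕ)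
    (s s' : MarkedStage.{u}) : Prop :=
  ∃ (C : s.W.IdealSheafData) (P' : Option (Pending (blowup C))) (h : IsLocallyNoetherian (blowup C))
    (x' : ↥(blowup C)),
    IsCanonicalStep R N ν s.L s.P C P' ∧ (blowup.π C).base x' = s.pt ∧
      s' = ⟨blowup C, h, s.L.next (Scheme.hsStratum s.W N ν) C, P', x'⟩ ∧ s.pt ∉ C.support

/-- [OURS · L1 W4.2] **W-fair at level `N` in characteristic `p`**: no chain of canonical near steps from a maximal origin is
eventually idle. [cite: CossartJannsenSaito2020, p. 92, Rem. 6.29 (1)] -/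
def WFair (p N : ℕ) : Prop :=
  ∀ (R : ∀ S : Scheme.{u}, CentreSeq S → Prop), OracleFunctional R → OracleAdmissible R →
  ∀ (ν : ℕ → ℕ) (X : Scheme.{u}) [IsLocallyNoetherian X] (x : X), IsMaximalOrigin p N ν X x →
  ∀ c : ℕ → MarkedStage.{u}, Reaches R N ν (MarkedStage.init X x) (c 0) →
    (∀ n, CanonicalNearStep R N ν (c n) (c (n + 1))) → ∀ n, ∃ m, n ≤ m ∧ ¬ CanonicalNearStep.IdleAt R N ν (c m) (c (m + 1))

/-! ## §C. The skeleton-level statements WA / WB -/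

/-- **WA: maximal-origin termination of `S(Y, ν)` at level 3 on `{dim ≤ 3}` GIVES a `ν`-modification** (oracle hidden).
PROVED modulo CJS Thm. 1.2 (`WA3_of_CJS`). OURS internal node (cf. CJS LNM 2270, Rem. 6.29, Def. 6.14, Thm. 1.2); not a citation
of print; not asserted. -/
def WA3 : Prop :=
  ∀ p : ℕ, p.Prime → (ClosedOriginNoNearChainAt.{0} p 3 fun _ => True) →
    ∀ (k : Type) [Field k] [CharP k p] (Y : Scheme.{0})
      (g : Y ⟶ Spec (.of k)), IsSeparated g → LocallyOfFiniteType g → QuasiCompact g →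
      IsReduced Y → topologicalKrullDim Y ≤ ((3 : ℕ) : WithBot ℕ∞) →
      ∀ ν : ℕ → ℕ, Maximal (· ∈ Scheme.hsValues Y 3) ν → ν ≠ iterPSum 3 Phi → NuMod Y 3 3 ν

/-- **WB (OPEN): no near chain from any maximal origin at level 3, in every prime characteristic.** OURS internal node (cf. CJS
LNM 2270, p. 107, Rem. 6.29); not a citation of print; not asserted. -/
def WB3 : Prop :=
  ∀ p : ℕ, p.Prime → ClosedOriginNoNearChainAt.{0} p 3 fun _ => True

/-! ## §D. REGIMES, POINTEDNESS, and THE ROWS BY NAME (v3.5 re-cut). `Q` is a predicate on the ORIGIN `(N, ν, X, x)`; splits are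
`by_cases`. W-low is cut along the printed standing assumption (F1) «`char k(x) = 0` or `char k(x) ≥ dim X/2 + 1`» (CJS p. 103,
Thm. 10.2; typed `CharHypothesis`): on `{dim ≤ 3}` in characteristic `p > 0` it reads «`3 ≤ p` or `dim X ≤ 2`» (`QCharRegime p`).
W-top is cut by pointedness `X(ν) = {x}` (card C′'s scope). NOT statements of any manuscript. -/
/-- [OURS · L1 W4.2] `ClosedOriginNoNearChainAt` restricted to closed origins satisfying `Q N ν X x`. [folklore] -/
def ClosedOriginNoNearChainAtQ (p N : ℕ) (Q : ℕ → (ℕ → ℕ) → ∀ X : Scheme.{u}, X → Prop)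
    (G : MarkedStage.{u} → Prop) : Prop :=
  ∀ (R : ∀ S : Scheme.{u}, CentreSeq S → Prop), OracleFunctional R → OracleAdmissible R →
  ∀ (ν : ℕ → ℕ) (X : Scheme.{u}) [IsLocallyNoetherian X] (x : X), IsMaximalOrigin p N ν X x → Q N ν X x →
    NoNearChainFrom R N ν (MarkedStage.init X x) G

/-- [OURS] Regime predicate: the residue field `κ(x)` is perfect (for a closed point of a `k`-variety: iff `k` is perfect;
tri-1 R2-β: at such points near points lie on `ℙ(Dir_x/T_x D)` in EVERY characteristic — to be proved as
`nearPoint_mem_proj_directrix_of_perfect_residueField`, not cited). [folklore] -/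
def QPerfectResidueField : ℕ → (ℕ → ℕ) → ∀ X : Scheme.{u}, X → Prop :=
  fun _ _ X x => PerfectField (IsLocalRing.ResidueField (X.presheaf.stalk x))

/-- [OURS] Pointedness predicate: the origin is ISOLATED in its stratum, `X(ν) = {x}` (= the campaign's `IsIsolatedOrigin`
shape; card C′'s scope). [folklore] -/
def QPointed : ℕ → (ℕ → ℕ) → ∀ X : Scheme.{u}, X → Prop :=
  fun N ν X x => Scheme.hsStratum X N ν = {x}

/-- [OURS] THE (F1) REGIME on `{dim ≤ 3}` in characteristic `p`: «`3 ≤ p` or `dim X ≤ 2`» — exactly where the printed standing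
assumption `CharHypothesis X x` of CJS Thms. 6.35/6.40 (p. 103, Thm. 10.2: `char = 0 ∨ dim X + 2 ≤ 2·char`) holds for a
scheme of dimension `≤ 3` over a field of characteristic `p > 0`. [cite: CossartJannsenSaito2020, Thm. 10.2] -/
def QCharRegime (p : ℕ) : ℕ → (ℕ → ℕ) → ∀ X : Scheme.{u}, X → Prop :=
  fun _ _ X _ => 3 ≤ p ∨ topologicalKrullDim X ≤ ((2 : ℕ) : WithBot ℕ∞)

/-- **ROW W-low-char (`stub_Wlow3_char`)**: in the (F1) regime, no infinite chain of CONSTANT grade `ē = e`, `e ≤ 2`, from a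
maximal origin at level `3` — the printed key theorems' territory (`e = 2`: Thm. 6.40 via `Bridge3`; `e = 1`: Cor. 6.37 via
`Bridge3Seq`; `e = 0`: no near point, Thm. 3.14 in the (F1) range). [cite: CossartJannsenSaito2020, Thm. 6.40, Cor. 6.37, Thm. 3.14] -/
def Wlow3Char (p : ℕ) : Prop :=
  ∀ e ≤ 2, ClosedOriginNoNearChainAtQ.{u} p 3 (QCharRegime p) fun s => s.geomDirDim = e

/-- **ROW W-low-two (`stub_Wlow3_two`, OURS)**: outside the (F1) regime (for a prime `p` this forces `p = 2` and `dim X = 3`), no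
infinite chain of constant grade `ē = e ≤ 2` from a maximal origin at level `3`. Helper rows: `Wlow3TwoPerfect` (β) and
`Wlow3TwoImperfect` (γ). [cite: CossartJannsenSaito2020, Thm. 6.40, Thm. 3.14] -/
def Wlow3Two (p : ℕ) : Prop :=
  ∀ e ≤ 2, ClosedOriginNoNearChainAtQ.{u} p 3 (fun N ν X x => ¬ QCharRegime p N ν X x) fun s => s.geomDirDim = e

/-- Helper row β of W-low-two: perfect residue field at the origin (tri-1 R2-β: near points on `ℙ(Dir_x/T_x D)` in every
characteristic at such points — OURS re-derivation, an AI reading of CJS Chs. 12–14). [cite: CossartJannsenSaito2020, Thm. 3.14, Thm. 6.40] -/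
def Wlow3TwoPerfect (p : ℕ) : Prop :=
  ∀ e ≤ 2, ClosedOriginNoNearChainAtQ.{u} p 3
    (fun N ν X x => ¬ QCharRegime p N ν X x ∧ QPerfectResidueField N ν X x) fun s => s.geomDirDim = e

/-- Helper row γ of W-low-two: imperfect residue field at the origin (OPEN; barrier `DirectrixSmallCharacteristic`; specimens
S4, D1–D4 of tri-1). [cite: CossartJannsenSaito2020, Thm. 3.14] -/
def Wlow3TwoImperfect (p : ℕ) : Prop :=
  ∀ e ≤ 2, ClosedOriginNoNearChainAtQ.{u} p 3
    (fun N ν X x => ¬ QCharRegime p N ν X x ∧ ¬ QPerfectResidueField N ν X x) fun s => s.geomDirDim = e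

/-- **ROW W-top-pointed (`stub_Wtop3_pointed`)**: no infinite chain of grade `ē ≥ 3` from a POINTED maximal origin `X(ν) = {x}`
at level `3` (card C′ via a `ShadowLaw`, §E). Vacuous from origins of dimension `≤ 2` (`canonicalNearStep_dim_le`).
[cite: CossartJannsenSaito2020, p. 107, §1.3] -/
def Wtop3Pointed (p : ℕ) : Prop :=
  ClosedOriginNoNearChainAtQ.{u} p 3 QPointed fun s => 3 ≤ s.geomDirDim

/-- **ROW W-top-nonpointed (`stub_Wtop3_nonpointed`, OPEN — THE CORE)**: no infinite chain of grade `ē ≥ 3` from a NON-pointed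
maximal origin at level `3` (obstruction O2 of CJS §1.3 in maximal-origin form; no card yet). [cite: CossartJannsenSaito2020, §1.3, p. 107] -/
def Wtop3Nonpointed (p : ℕ) : Prop :=
  ClosedOriginNoNearChainAtQ.{u} p 3 (fun N ν X x => ¬ QPointed N ν X x) fun s => 3 ≤ s.geomDirDim

/-! ## §E. THE SHADOW-LAW INTERFACE (v3.4) — tri-2's STAGEWISE σ-repair of card C′ (`Tri2CardC.lean`: as typed,
`ShadowingLemma3 ↔ (G3LTerminates → target)`), typed GENERICALLY so that the card's remaining obligations become the FIELDS of
one structure and the reduction to the W-top-pointed row is PROVED here. A shadow law for grade `G` from `Q`-origins consists of: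
a type of shadow states `St` with a step relation and a `good` predicate; a shadow map `σ` and a BUDGET `budget : MarkedStage → ℕ`
(card C′: residue-degree / non-linear-near-centre budget K3a/K3b); the LAW: along every canonical near step between in-scope
`G`-stages EITHER the shadow steps and the budget does not grow, OR the budget strictly drops (the «budget-eater» steps); `good`
holds at the shadow of every in-scope `G`-stage (C′: `IsGrade3`, shadow fidelity K3c); and TERMINATION of good shadow plays
(C′: `G3LTerminates`). Instantiation for C′: `St := ShadowState`, `step := ShadowStep`, `good s := IsGrade3 s.A`, `σ` READ OFF
the stage (generating points of Δ(f;y;u) in absorbed coordinates + labels), `Q := QPointed`, `G := (3 ≤ ē)`. NOT a statement of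
any manuscript. -/

/-- [OURS · L1 W4.2] `s` is reached along `S(X, ν)` from a maximal origin of characteristic `p` satisfying `Q`. [folklore] -/
def InScopeCQ (p : ℕ) (R : ∀ S : Scheme.{u}, CentreSeq S → Prop) (N : ℕ) (ν : ℕ → ℕ)
    (Q : ℕ → (ℕ → ℕ) → ∀ X : Scheme.{u}, X → Prop) (s : MarkedStage.{u}) : Prop :=
  ∃ (X : Scheme.{u}) (h : IsLocallyNoetherian X) (x : X),
    IsMaximalOrigin p N ν X x ∧ Q N ν X x ∧ Reaches R N ν (@MarkedStage.init X h x) s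

/-- [OURS · L1 W4.2] A SHADOW LAW for grade `G` at level `N` in characteristic `p` from `Q`-origins (see the section
docstring). [folklore] -/
structure ShadowLaw (p N : ℕ) (Q : ℕ → (ℕ → ℕ) → ∀ X : Scheme.{u}, X → Prop) (G : MarkedStage.{u} → Prop) :
    Type (u + 2) where
  /-- shadow states -/
  St : Type
  /-- the shadow step (C′: `ShadowStep`, the silenced-B labelled monomial game move) -/
  step : St → St → Prop
  /-- good states (C′: grade-3 generating sets) -/
  good : St → Prop
  /-- the shadow map, READ OFF the marked stage -/
  σ : MarkedStage.{u} → St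
  /-- the budget for non-shadowed steps (C′: K3a/K3b) -/
  budget : MarkedStage.{u} → ℕ
  /-- every in-scope `G`-stage has a good shadow (C′: fidelity K3c) -/
  good_of_scope : ∀ (R : ∀ S : Scheme.{u}, CentreSeq S → Prop), OracleFunctional R → OracleAdmissible R →
    ∀ (ν : ℕ → ℕ) (s : MarkedStage.{u}), InScopeCQ p R N ν Q s → G s → good (σ s)
  /-- THE ONE-STEP LAW -/
  law : ∀ (R : ∀ S : Scheme.{u}, CentreSeq S → Prop), OracleFunctional R → OracleAdmissible R →
    ∀ (ν : ℕ → ℕ) (s s' : MarkedStage.{u}), InScopeCQ p R N ν Q s → G s → G s' →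
      CanonicalNearStep R N ν s s' → (step (σ s) (σ s') ∧ budget s' ≤ budget s) ∨ budget s' < budget s
  /-- good shadow plays terminate (C′: `G3LTerminates`) -/
  terminates : ∀ f : ℕ → St, good (f 0) → ¬ ∀ n, step (f n) (f (n + 1))

/-! ## §F. THE F-KEY BRIDGES (stub-2's SIGNATURE-PROPOSAL 02:28:02Z, ADOPTED WITH AMENDMENTS by CHAIN v3.6): low-grade canonical near
chains ↦ the carriers of res-type-053's typed key theorems (`KeyTheorems.lean`, p484877; `KeyTheoremsIsolated.lean`, p486755).
Amendments: (a) grade EXACTLY `2` for the unit bridge (grade-`1` tails go to Cor. 6.37 through `Bridge3Seq`, grade-`0` tails have no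
near point); (b) origin in the (F1) regime `QCharRegime p` (the complement is row W-low-two, not a bridge); (c) the prover may pass
to any tail of the chain and chooses the modelling (flat base change to `Spec 𝒪_{X_n,x_n}`, tree `BlowupsFlatBaseChange`; compression
of idle steps by `WFair`) — the interface hides it. Obligations inside (CHAIN v3.5 §0d): B-req-1 quasi-isolation at unit starts (G1
`interleavedCurveInvariance3`), B-req-2 unit recognition (Def. 6.38 (ii)–(v) along the run: CJS Lemma 6.23 / Thm. 6.17-type content),
B-req-3 contiguity / compression, B-req-4 `e = ē = 2` at unit ends (F3). Citation of record for the consumer: `KeyTheorem640_char`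
(print-faithful, res-lit-6 02:43:16Z; fallback `KeyTheorem640_char_isolated` via `KeyTheorem640_char_isolated_of`). NOT statements of
any manuscript. -/

section Bridge

open Literature.AlgebraicGeometry.CossartJannsenSaito2020

/-- [OURS · L1 W4.2] **The unit bridge at characteristic `p`**: every chain of canonical near steps at level `3` of constant
grade `ē = 2`, reached from a maximal origin in the (F1) regime, yields the antecedents of `KeyTheorem640_char` — a blow-up
tower in the key setting, the characteristic hypothesis at the first initial point, a chain of fundamental units cut out of
the tower, and the local no-regular-curve hypothesis at every initial point. [cite: CossartJannsenSaito2020, Def. 6.38, Def. 6.39, Thm. 6.40] -/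
def Bridge3 (p : ℕ) : Prop :=
  ∀ (R : ∀ S : Scheme.{0}, CentreSeq S → Prop), OracleFunctional R → OracleAdmissible R →
  ∀ (ν : ℕ → ℕ) (X : Scheme.{0}) [IsLocallyNoetherian X] (x : X), IsMaximalOrigin p 3 ν X x → QCharRegime p 3 ν X x →
  ∀ c : ℕ → MarkedStage.{0}, Reaches R 3 ν (MarkedStage.init X x) (c 0) →
    (∀ n, CanonicalNearStep R 3 ν (c n) (c (n + 1))) → (∀ n, (c n).geomDirDim = 2) →
    ∃ (T : BlowupTower.{0}) (len : ℕ → ℕ) (pt : ∀ i, T.X (unitStart len i)),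
      KeySetting T 3 ∧ CharHypothesis (T.X 0) (pt 0) ∧ IsChainOfFundamentalUnits T 3 len pt ∧
      ∀ i, @NoRegularSubschemeInHSLocus (T.X (unitStart len i)) (T.ln _) 3 (pt i) 1

/-- [OURS · L1 W4.2] **The point-sequence bridge at characteristic `p`** (grade `1`): every chain of canonical near steps at
level `3` of constant grade `ē = 1`, reached from a maximal origin in the (F1) regime, yields an INFINITE fundamental sequence
(Def. 6.34, `m = ⊤`) over a point isolated in its Hilbert–Samuel locus with `e = 1`, in the key setting with the characteristic
hypothesis — the antecedents of `Corollary637_char` with `m = ⊤`. [cite: CossartJannsenSaito2020, Def. 6.34, Cor. 6.37] -/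
def Bridge3Seq (p : ℕ) : Prop :=
  ∀ (R : ∀ S : Scheme.{0}, CentreSeq S → Prop), OracleFunctional R → OracleAdmissible R →
  ∀ (ν : ℕ → ℕ) (X : Scheme.{0}) [IsLocallyNoetherian X] (x : X), IsMaximalOrigin p 3 ν X x → QCharRegime p 3 ν X x →
  ∀ c : ℕ → MarkedStage.{0}, Reaches R 3 ν (MarkedStage.init X x) (c 0) →
    (∀ n, CanonicalNearStep R 3 ν (c n) (c (n + 1))) → (∀ n, (c n).geomDirDim = 1) →
    ∃ (T : BlowupTower.{0}) (x₀ : T.X 0),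
      KeySetting T 3 ∧ CharHypothesis (T.X 0) x₀ ∧ IsFundamentalSequence T 3 x₀ ⊤ ∧
      @IsIsolatedInHSMaxLocus (T.X 0) (T.ln 0) 3 x₀ ∧ T.dirDimAt 0 x₀ = 1

end Bridge


end Summit.ResolutionOfSingularities.ResolutionOfSingularities.Theorems.SigmaMaxModificationsCorridor3.Helpers

end
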